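import Mathlib
import Summits.Ventures.PercRepro2.Independence
import Summits.Ventures.PercRepro2.Harris
import Summits.Ventures.PercRepro2.HCov
import Summits.Ventures.PercRepro2.HCovCard5
import Summits.Ventures.PercRepro2.CycleNecklaceConn
import Summits.Ventures.PercRepro2.CycleTheorem

/-!
# (HCOV) on every necklace (blind cell PercRepro2, typer-1 g48)

For a necklace (`IsNecklace`, `CycleNecklaceConn.lean`) the block weights `nkProb p j` are the
probabilities that block `j` connects its terminals inside itself.

* **`prob_nkOpen_preimage`**: the law of the pattern `nkOpen` is the product law of the block
  weights (the blocks are disjoint edge sets, `prob_inter_eq_mul_of_dependsOn`);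
* **`HCov_necklace`** / **`ZDelta_necklace`**: (HCOV), resp. the crux of record under
  `P(a₁ ↔ b) ≤ P(a₂ ↔ b)`, for every admissible weight vector and every placement of the five
  labels on the five marks — with `conn_marks_iff_nk` the covariance form transports to `C₅`
  (`Gc_transport'`), where the `K₅` certificate decides (`Cycle5.HCov_cycle5`).  No closed forms.
-/

namespace Summit.Ventures.PercRepro2

namespace Cycle

section NecklaceLaw

variable {V : Type*} {E : Type*} [Fintype E] [DecidableEq E]
variable {ends : E → Sym2 V} {q : Fin 5 → V} {blk : E → Fin 5} {Vj : Fin 5 → Set V}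

/-! ### The law of the necklace pattern -/

variable {R : Type*} [Field R]

/-- The block weights: the probability that block `j` connects its terminals inside itself. -/
noncomputable def nkProb (ends : E → Sym2 V) (q : Fin 5 → V) (blk : E → Fin 5) (p : E → R)
    (j : Fin 5) : R :=
  prob p {ω | Conn ends (blockCfg blk j ω) (q j) (q (j + 1))}

/-- The block weights are admissible. -/
lemma isProbVec_nkProb [LinearOrder R] [IsStrictOrderedRing R] {p : E → R} (hp : IsProbVec p) :
    IsProbVec (nkProb ends q blk p) where
  nonneg _ := prob_nonneg hp _
  le_one _ := prob_le_one hp _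

/-- The event `{nkOpen ω j = σ j}`. -/
def nkEvent (ends : E → Sym2 V) (q : Fin 5 → V) (blk : E → Fin 5) (σ : Config (Fin 5)) (j : Fin 5) :
    Set (Config E) :=
  {ω | nkOpen ends q blk ω j = σ j}

omit [Fintype E] [DecidableEq E] in
/-- Two configurations agreeing on block `j` have the same block-`j` configuration. -/
lemma blockCfg_congr {j : Fin 5} {ω ω' : Config E} (h : ∀ e ∈ {e | blk e = j}, ω e = ω' e) :
    blockCfg blk j ω = blockCfg blk j ω' := by
  funext e
  simp only [blockCfg]
  by_cases hj : blk e = j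
  · rw [h e hj]
  · simp [hj]

omit [Fintype E] [DecidableEq E] in
/-- `{nkOpen ω j = σ j}` is determined by the edges of block `j`. -/
lemma dependsOn_nkEvent (σ : Config (Fin 5)) (j : Fin 5) :
    DependsOn (· ∈ nkEvent ends q blk σ j) {e | blk e = j} := by
  intro ω ω' h
  simp only [nkEvent, Set.mem_setOf_eq, nkOpen]
  rw [blockCfg_congr h]

/-- The probability that block `j` shows the state `σ j`. -/
lemma prob_nkEvent (p : E → R) (σ : Config (Fin 5)) (j : Fin 5) :
    prob p (nkEvent ends q blk σ j) = edgeFactor (nkProb ends q blk p j) (σ j) := by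
  cases hσ : σ j
  · have : nkEvent ends q blk σ j = {ω | Conn ends (blockCfg blk j ω) (q j) (q (j + 1))}ᶜ := by
      ext ω
      simp only [nkEvent, Set.mem_setOf_eq, hσ, Set.mem_compl_iff, nkOpen_eq_false_iff]
    rw [this, prob_compl]
    rfl
  · have : nkEvent ends q blk σ j = {ω | Conn ends (blockCfg blk j ω) (q j) (q (j + 1))} := by
      ext ω
      simp only [nkEvent, Set.mem_setOf_eq, hσ, nkOpen_eq_true_iff]
    rw [this]
    rfl

/-- **Independence of the blocks**: the probability of a conjunction of block events over a set
of blocks is the product. -/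
lemma prob_biInter_nkEvent (p : E → R) (σ : Config (Fin 5)) (s : Finset (Fin 5)) :
    prob p (⋂ j ∈ s, nkEvent ends q blk σ j) = ∏ j ∈ s, prob p (nkEvent ends q blk σ j) ∧
    DependsOn (· ∈ ⋂ j ∈ s, nkEvent ends q blk σ j) {e | blk e ∈ s} := by
  induction s using Finset.induction_on with
  | empty =>
    refine ⟨by simp, ?_⟩
    intro ω ω' _
    simp
  | insert j s hj ih =>
    obtain ⟨ih1, ih2⟩ := ih
    have hdisj : Disjoint {e | blk e = j} {e | blk e ∈ s} := by
      rw [Set.disjoint_left]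
      intro e he he'
      simp only [Set.mem_setOf_eq] at he he'
      exact hj (he ▸ he')
    rw [Finset.set_biInter_insert]
    refine ⟨?_, ?_⟩
    · rw [prob_inter_eq_mul_of_dependsOn p hdisj
        (dependsOn_nkEvent (ends := ends) (q := q) (blk := blk) σ j) ih2, ih1,
        Finset.prod_insert hj]
    · have := dependsOn_inter (dependsOn_nkEvent (ends := ends) (q := q) (blk := blk) σ j) ih2
      have hset : ({e | blk e = j} ∪ {e | blk e ∈ s} : Set E) = {e | blk e ∈ insert j s} := by
        ext e
        simp [Finset.mem_insert]
      rwa [hset] at this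

omit [Fintype E] [DecidableEq E] in
/-- The fibre of the pattern is the conjunction of the block events. -/
lemma nkOpen_fibre_eq (σ : Config (Fin 5)) :
    {ω : Config E | nkOpen ends q blk ω = σ} =
      ⋂ j ∈ (Finset.univ : Finset (Fin 5)), nkEvent ends q blk σ j := by
  ext ω
  simp only [Set.mem_setOf_eq, Set.mem_iInter, Finset.mem_univ, nkEvent, true_implies]
  exact ⟨fun h j => by rw [h], fun h => funext h⟩

/-- **The law of the necklace pattern is the product law of the block weights.** -/
theorem prob_nkOpen_eq (p : E → R) (σ : Config (Fin 5)) :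
    prob p {ω | nkOpen ends q blk ω = σ} = weight (nkProb ends q blk p) σ := by
  rw [nkOpen_fibre_eq, (prob_biInter_nkEvent p σ Finset.univ).1]
  unfold weight
  exact Finset.prod_congr rfl fun j _ => prob_nkEvent p σ j

/-- **Pushforward**: the probability of a pattern event in the necklace is its probability in
`C₅` at the block weights. -/
theorem prob_nkOpen_preimage (p : E → R) (A : Set (Config (Fin 5))) :
    prob p (nkOpen ends q blk ⁻¹' A) = prob (nkProb ends q blk p) A := by
  classical
  calc prob p (nkOpen ends q blk ⁻¹' A)
      = ∑ ω, (nkOpen ends q blk ⁻¹' A).indicator (weight p) ω := rfl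
    _ = ∑ σ, ∑ ω ∈ Finset.univ.filter (fun ω => nkOpen ends q blk ω = σ),
          (nkOpen ends q blk ⁻¹' A).indicator (weight p) ω :=
        (Finset.sum_fiberwise Finset.univ (nkOpen ends q blk) _).symm
    _ = ∑ σ, A.indicator (fun σ => prob p {ω | nkOpen ends q blk ω = σ}) σ := by
        refine Finset.sum_congr rfl fun σ _ => ?_
        by_cases hA : σ ∈ A
        · rw [Set.indicator_of_mem hA]
          unfold prob
          rw [Finset.sum_filter]
          refine Finset.sum_congr rfl fun ω _ => ?_
          by_cases hω : nkOpen ends q blk ω = σ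
          · rw [if_pos hω, Set.indicator_of_mem (show ω ∈ {ω | nkOpen ends q blk ω = σ} from hω),
              Set.indicator_of_mem (show ω ∈ nkOpen ends q blk ⁻¹' A from by
                rw [Set.mem_preimage, hω]; exact hA)]
          · rw [if_neg hω,
              Set.indicator_of_notMem (show ω ∉ {ω | nkOpen ends q blk ω = σ} from hω)]
        · rw [Set.indicator_of_notMem hA]
          refine Finset.sum_eq_zero fun ω hω => ?_
          rw [Finset.mem_filter] at hω
          rw [Set.indicator_of_notMem]
          rw [Set.mem_preimage, hω.2]
          exact hA
    _ = ∑ σ, A.indicator (weight (nkProb ends q blk p)) σ := by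
        refine Finset.sum_congr rfl fun σ _ => ?_
        by_cases hA : σ ∈ A
        · rw [Set.indicator_of_mem hA, Set.indicator_of_mem hA, prob_nkOpen_eq]
        · rw [Set.indicator_of_notMem hA, Set.indicator_of_notMem hA]
    _ = prob (nkProb ends q blk p) A := rfl

/-! ### (HCOV) on every necklace -/

variable [LinearOrder R] [IsStrictOrderedRing R]

/-- **(HCOV) on every necklace** for every admissible weight vector and every placement of the five
labels on the five marks: the mark connectivities are those of `C₅` under the pattern
(`conn_marks_iff_nk`), whose law is the product law of the block weights (`prob_nkOpen_preimage`),
so `Gc` transports to `C₅` (`Gc_transport'`), where the `K₅` certificate decides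
(`Cycle5.HCov_cycle5`). -/
theorem HCov_necklace (hN : IsNecklace ends q blk Vj) (p : E → R) (hp : IsProbVec p)
    (ko k₁ k₂ k₃ kb : Fin 5) (h01 : ko ≠ k₁) (h02 : ko ≠ k₂) (h03 : ko ≠ k₃) (h04 : ko ≠ kb)
    (h12 : k₁ ≠ k₂) (h13 : k₁ ≠ k₃) (h14 : k₁ ≠ kb) (h23 : k₂ ≠ k₃) (h24 : k₂ ≠ kb) (h34 : k₃ ≠ kb) :
    CovForm.HCov p ends (q ko) (q k₁) (q k₂) (q k₃) (q kb) := by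
  have key : CovForm.Gc (nkProb ends q blk p) (cycN 5) ko k₁ k₂ k₃ kb =
      CovForm.Gc p ends (q ko) (q k₁) (q k₂) (q k₃) (q kb) :=
    Gc_transport' (fun A => (prob_nkOpen_preimage p A).symm)
      (fun ω x z => (conn_marks_iff_nk hN ω x z).symm) ko k₁ k₂ k₃ kb
  unfold CovForm.HCov
  rw [← key]
  exact Cycle5.HCov_cycle5 (nkProb ends q blk p) (isProbVec_nkProb hp) ko k₁ k₂ k₃ kb
    h01 h02 h03 h04 h12 h13 h14 h23 h24 h34

/-- **The crux of record on every necklace** under `P(a₁ ↔ b) ≤ P(a₂ ↔ b)`. -/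
theorem ZDelta_necklace [Fintype V] [DecidableEq V] (hN : IsNecklace ends q blk Vj) (p : E → R)
    (hp : IsProbVec p)
    (ko k₁ k₂ k₃ kb : Fin 5) (h01 : ko ≠ k₁) (h02 : ko ≠ k₂) (h03 : ko ≠ k₃) (h04 : ko ≠ kb)
    (h12 : k₁ ≠ k₂) (h13 : k₁ ≠ k₃) (h14 : k₁ ≠ kb) (h23 : k₂ ≠ k₃) (h24 : k₂ ≠ kb) (h34 : k₃ ≠ kb)
    (hord : prob p (connEvent ends (q k₁) (q kb)) ≤ prob p (connEvent ends (q k₂) (q kb))) :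
    ZDelta p ends (q ko) (q k₁) (q k₂) (q k₃) (q kb) :=
  CovForm.ZDelta_of_HCov p hp ends hord
    (HCov_necklace hN p hp ko k₁ k₂ k₃ kb h01 h02 h03 h04 h12 h13 h14 h23 h24 h34)

end NecklaceLaw

end Cycle

end Summit.Ventures.PercRepro2
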